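import Summits.NavierStokesRegularity.NavierStokesRegularity.Theorems.RecurrentProfilesRecurrentLiouvilleClockVorticityFloor
import Summits.NavierStokesRegularity.NavierStokesRegularity.Theorems.SqueezeCycleExtremalElementExistsRegularity
import Literature.Analysis.FluidPDE.TypeIRateOseenMildRepresentative
import Literature.Analysis.FluidPDE.TypeIAncientMild
import HarnessLib

/-!
# Crux `RecurrentLiouville` (stmt-NavierStokesRegularity-1589), line `Sketch` (v6, Giga–Kohn harvest) —
# stub S1 `stub_gkWindowIncrementRemoval`: window increment removal

Theorems-only file (no definitions, no named facts).  For every rate `C` and bound `M < ⊤` there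
are `R > 0` and `δ > 0` such that a suitable weak solution `(u, p)` of Navier–Stokes (`ν = 1`) on
`ℝ³ × ℝ₋` with weak gradient `G`, Albritton–Barker quantity `𝐈 ≤ M` and the Type-I rate
`‖u(t,x)‖ ≤ C/√(−t)`, whose scaling-orbit increments
`∫_{(−2,−1)×B_R} ‖c u(c²t, cx) − u(t,x)‖² dx dt` are `≤ δ` for every scale factor `1 ≤ c ≤ √2`, is
regular at the space–time origin.

Proof (recurrence-free, by contradiction + compactness).  Bad profiles `u_k` with `R_k = k+1`,
`δ_k = 1/(k+1)`, all origin-singular: Albritton–Barker compactness (`stub_rlClassLimit`) gives an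
origin-singular `L³_loc` class limit `V`; the continuous Oseen-mild representatives `v_k` of the
`u_k` (`exists_oseenMild_repr_of_typeIBound_lt_top`, Type-I ancient mild by KNSS Prop. 4.1) have a
further subsequence converging pointwise on the open slab to a Type-I ancient mild field `W` (KNSS
Lemma 6.1, `exists_tendsto_of_typeI_seq_Ioo`), origin-singular because the two limits agree a.e.
(`isBackwardSingularPoint_of_L3_limit_of_pointwise_limit`).  The increments of the `v_k` equal
those of the `u_k` (a.e.-congruence, stub S3) and tend to `0` on every box, so `W` is scale
invariant on the window `(−2,−1)` (Fatou + continuity, stub S1a); by Leray's reduction on the window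
and Tsai's theorem the slice `W(−3/2)` is constant (stub S4) — contradicting
`exists_curl_ne_zero_of_isBackwardSingularPoint` (an origin-singular Type-I ancient mild field has
no irrotational slice: div–curl Liouville + forward uniqueness).

This file proves the assembly `stub_gkRemovalCore` with the three sibling stubs S1a, S3(ii), S4 as explicit
hypotheses; the registered stub `stub_gkWindowIncrementRemoval` follows by feeding the landed stubs
(registered tools stub `stub_gkRemovalCore`).

## References

* T.-P. Tsai, Arch. Rational Mech. Anal. 143 (1998), Thm 1. [Tsai1998]
* G. Koch, N. Nadirashvili, G. Seregin, V. Šverák, Acta Math. 203 (2009) = arXiv:0709.3599,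
  Prop. 4.1, Lemma 6.1. [KochNadirashviliSereginSverak2009]
* D. Albritton, T. Barker, J. Math. Fluid Mech. 21 (2019) = arXiv:1811.00502, Lemma 2.2,
  Prop. 2.3, §3. [AlbrittonBarker2019]
-/

noncomputable section

-- the sub-problem namespace repeats the summit name (D-0017 layout `Summit.<S>.<P>.Theorems`)
set_option linter.dupNamespace false

namespace Summit.NavierStokesRegularity.NavierStokesRegularity.Theorems

open MeasureTheory Set Function Filter Topology TopologicalSpace Metric
open Literature.Analysis Literature.Analysis.FluidPDE
open scoped NNReal ENNReal

/-- The curl of a constant field vanishes (private copy; the tree's `curl_const` lives in a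
`Negative/` file of another crux, outside this import closure). [folklore] -/
private theorem gkS1_curl_const (b x : EuclideanSpace ℝ (Fin 3)) :
    curl (fun _ => b) x = 0 := by
  simp [curl]

/-- **Window increment removal — the assembly** (registered tools stub `stub_gkRemovalCore`), with
the three sibling stubs as hypotheses:
`hInv` = S1a (vanishing increments pass to pointwise limits), `hCongr` = S3(ii) (a.e.-congruence of
the increment functional), `hLeray` = S4 (window Leray: a constant slice). [cite: Tsai1998, Thm 1;
AlbrittonBarker2019, Lemma 2.2, Prop. 2.3 and §3; KochNadirashviliSereginSverak2009, Lemma 6.1] -/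
theorem stub_gkRemovalCore :
    (∀ (w : ℕ → ℝ → EuclideanSpace ℝ (Fin 3) → EuclideanSpace ℝ (Fin 3))
      (W : ℝ → EuclideanSpace ℝ (Fin 3) → EuclideanSpace ℝ (Fin 3)),
      (∀ k, ContinuousOn (uncurry (w k)) (Iio (0 : ℝ) ×ˢ univ)) →
      ContinuousOn (uncurry W) (Iio (0 : ℝ) ×ˢ univ) →
      (∀ t : ℝ, t < 0 → ∀ x, Tendsto (fun k => w k t x) atTop (𝓝 (W t x))) →
      (∀ R : ℝ, 0 < R → ∀ c : ℝ, 1 ≤ c → c ^ 2 ≤ 2 →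
        Tendsto (fun k => ∫⁻ z in Ioo (-2 : ℝ) (-1) ×ˢ Metric.ball (0 : EuclideanSpace ℝ (Fin 3)) R,
          ‖nsRescale c (w k) z.1 z.2 - w k z.1 z.2‖ₑ ^ 2) atTop (𝓝 0)) →
      ∀ c : ℝ, 1 ≤ c → c ^ 2 ≤ 2 → ∀ t ∈ Ioo (-2 : ℝ) (-1), ∀ x : EuclideanSpace ℝ (Fin 3),
        nsRescale c W t x = W t x) →
    (∀ (u v : ℝ → EuclideanSpace ℝ (Fin 3) → EuclideanSpace ℝ (Fin 3)) (c R : ℝ), 0 < c →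
      (∀ᵐ z ∂(volume.restrict (Iio (0 : ℝ) ×ˢ (univ : Set (EuclideanSpace ℝ (Fin 3))))),
        uncurry u z = uncurry v z) →
        ∫⁻ z in Ioo (-2 : ℝ) (-1) ×ˢ Metric.ball (0 : EuclideanSpace ℝ (Fin 3)) R,
            ‖nsRescale c u z.1 z.2 - u z.1 z.2‖ₑ ^ 2 =
          ∫⁻ z in Ioo (-2 : ℝ) (-1) ×ˢ Metric.ball (0 : EuclideanSpace ℝ (Fin 3)) R,
            ‖nsRescale c v z.1 z.2 - v z.1 z.2‖ₑ ^ 2) →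
    (∀ (C : ℝ) (W : ℝ → EuclideanSpace ℝ (Fin 3) → EuclideanSpace ℝ (Fin 3)),
      IsTypeIAncientMild C W →
      (∀ c : ℝ, 1 ≤ c → c ^ 2 ≤ 2 → ∀ t ∈ Ioo (-2 : ℝ) (-1), ∀ x : EuclideanSpace ℝ (Fin 3),
        nsRescale c W t x = W t x) →
      ∃ b : EuclideanSpace ℝ (Fin 3), ∀ x : EuclideanSpace ℝ (Fin 3), W (-3 / 2) x = b) →
    ∀ (C : ℝ) (M : ℝ≥0∞), M < ⊤ →
      ∃ R : ℝ, 0 < R ∧ ∃ δ : ℝ, 0 < δ ∧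
        ∀ (u : ℝ → EuclideanSpace ℝ (Fin 3) → EuclideanSpace ℝ (Fin 3))
          (p : ℝ → EuclideanSpace ℝ (Fin 3) → ℝ)
          (G : ℝ → EuclideanSpace ℝ (Fin 3) → EuclideanSpace ℝ (Fin 3) →L[ℝ] EuclideanSpace ℝ (Fin 3)),
          IsSuitableWeakSolutionOn (slab (EuclideanSpace ℝ (Fin 3)) (Iio 0) isOpen_Iio) 1 0 u p →
          HasWeakSpatialGradientOn (slab (EuclideanSpace ℝ (Fin 3)) (Iio 0) isOpen_Iio) u G →
          typeIBound (Iio (0 : ℝ) ×ˢ univ) u p G ≤ M →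
          HasTypeITimeDecay C u →
          (∀ c : ℝ, 1 ≤ c → c ^ 2 ≤ 2 →
            ∫⁻ z in Ioo (-2 : ℝ) (-1) ×ˢ Metric.ball (0 : EuclideanSpace ℝ (Fin 3)) R,
              ‖nsRescale c u z.1 z.2 - u z.1 z.2‖ₑ ^ 2 ≤ ENNReal.ofReal δ) →
          ¬ IsBackwardSingularPoint u 0 := by
  intro hInv hCongr hLeray C M hM
  by_contra hcon
  push Not at hcon
  -- ## (1) bad profiles: `R_k = k + 1`, `δ_k = 1/(k+1)`, all origin-singular
  have hRk : ∀ k : ℕ, (0 : ℝ) < (k : ℝ) + 1 := fun k => by positivity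
  have hδk : ∀ k : ℕ, (0 : ℝ) < 1 / ((k : ℝ) + 1) := fun k => by positivity
  choose u p G hsw hwg hI hdec hsmall hsing using
    fun k : ℕ => hcon ((k : ℝ) + 1) (hRk k) (1 / ((k : ℝ) + 1)) (hδk k)
  -- ## (2) the continuous Oseen-mild representatives (A–B Thm 1.1 forward; KNSS Prop. 4.1)
  have hrep : ∀ k, ∃ v : ℝ → EuclideanSpace ℝ (Fin 3) → EuclideanSpace ℝ (Fin 3),
      IsTypeIAncientMild C v ∧
      ∀ᵐ z ∂(volume.restrict (Iio (0 : ℝ) ×ˢ (univ : Set (EuclideanSpace ℝ (Fin 3))))),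
        uncurry (u k) z = uncurry v z := by
    intro k
    obtain ⟨v, hae, hcont, hdiv, hmild, hrate⟩ :=
      exists_oseenMild_repr_of_typeIBound_lt_top (hsw k) (hdec k) (lt_of_le_of_lt (hI k) hM)
    exact ⟨v, isTypeIAncientMild_of_continuous_oseenMild hcont hdiv hmild hrate, hae⟩
  choose v hv hae using hrep
  -- ## (3) the origin-singular `L³_loc` class limit (A–B Lemma 2.2 + Prop. 2.3)
  obtain ⟨V, q', H', ψ, hψ, -, hwgV, -, -, hsingV, hconv⟩ :=
    stub_rlClassLimit C M hM u p G hsw hwg hI hdec hsing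
  -- ## (4) the `C¹_loc` limit of the representatives (KNSS Lemma 6.1)
  set A : ℕ → ℝ := fun j => -((j : ℝ) + 1) with hA
  have hAlim : Tendsto A atTop atBot :=
    tendsto_neg_atTop_atBot.comp (tendsto_atTop_add_const_right _ _ tendsto_natCast_atTop_atTop)
  obtain ⟨φ, hφ, W, hW, hpt, -, -, -⟩ :=
    exists_tendsto_of_typeI_seq_Ioo C hAlim (w := fun j => v (ψ j))
      (fun j => (hv (ψ j)).continuousOn_uncurry.mono (prod_mono Ioo_subset_Iio_self Subset.rfl))
      (fun j t ht => (hv (ψ j)).isWeaklyDivFree ht.2)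
      (fun j s t _ hst ht x => (hv (ψ j)).mild_eq_heatExtension hst ht x)
      (fun j t ht x => (hv (ψ j)).norm_le ht.2 x)
  -- ## (5) the singularity passes to `W`: the two limits agree a.e. on every `Q(0, a)`
  have hsingW : IsBackwardSingularPoint W ((0 : ℝ), (0 : EuclideanSpace ℝ (Fin 3))) := by
    refine isBackwardSingularPoint_of_L3_limit_of_pointwise_limit (w := fun j => v (ψ (φ j)))
      (V := V) (fun j a _ => ?_) (fun a _ => ?_) (fun a ha => ?_) (fun t ht x => hpt t ht x) hsingV
    · exact ((hv (ψ (φ j))).continuousOn_uncurry.mono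
        (parabolicCylinder_origin_subset_slab a)).aestronglyMeasurable
        (isOpen_parabolicCylinder _ _).measurableSet
    · exact hwgV.locallyIntegrableOn.aestronglyMeasurable.mono_measure
        (Measure.restrict_mono (parabolicCylinder_origin_subset_slab a) le_rfl)
    · refine ((hconv a ha).comp hφ.tendsto_atTop).congr fun j => eLpNorm_congr_ae ?_
      have haeQ : ∀ᵐ z ∂(volume.restrict
          (parabolicCylinder a ((0 : ℝ), (0 : EuclideanSpace ℝ (Fin 3))))),
          uncurry (u (ψ (φ j))) z = uncurry (v (ψ (φ j))) z :=
        ae_restrict_of_ae_restrict_of_subset (parabolicCylinder_origin_subset_slab a) (hae _)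
      filter_upwards [haeQ] with z hz
      rw [Pi.sub_apply, Pi.sub_apply, hz]
  -- ## (6) the increments of the representatives tend to `0` on every box
  have hincr : ∀ R : ℝ, 0 < R → ∀ c : ℝ, 1 ≤ c → c ^ 2 ≤ 2 →
      Tendsto (fun j => ∫⁻ z in Ioo (-2 : ℝ) (-1) ×ˢ
          Metric.ball (0 : EuclideanSpace ℝ (Fin 3)) R,
        ‖nsRescale c (v (ψ (φ j))) z.1 z.2 - v (ψ (φ j)) z.1 z.2‖ₑ ^ 2) atTop (𝓝 0) := by
    intro R hR c hc1 hc2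
    have hc0 : 0 < c := lt_of_lt_of_le one_pos hc1
    -- the upper envelope `1/(ψ(φ j) + 1) → 0`
    have hup : Tendsto (fun j => ENNReal.ofReal (1 / (((ψ (φ j) : ℕ) : ℝ) + 1))) atTop (𝓝 0) := by
      have h1 : Tendsto (fun j => (1 : ℝ) / (((ψ (φ j) : ℕ) : ℝ) + 1)) atTop (𝓝 0) :=
        (tendsto_one_div_add_atTop_nhds_zero_nat (𝕜 := ℝ)).comp (hψ.comp hφ).tendsto_atTop
      have h2 := (ENNReal.continuous_ofReal.tendsto 0).comp h1
      rwa [ENNReal.ofReal_zero] at h2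
    refine tendsto_of_tendsto_of_tendsto_of_le_of_le' tendsto_const_nhds hup
      (Eventually.of_forall fun _ => zero_le) ?_
    -- eventually `R ≤ ψ(φ j) + 1`, and then the increment is `≤ 1/(ψ(φ j) + 1)`
    obtain ⟨N, hN⟩ := exists_nat_ge R
    refine eventually_atTop.2 ⟨N, fun j hj => ?_⟩
    have hjR : R ≤ ((ψ (φ j) : ℕ) : ℝ) + 1 := by
      have h1 : (N : ℝ) ≤ ((ψ (φ j) : ℕ) : ℝ) := by
        exact_mod_cast hj.trans ((hφ.id_le j).trans (hψ.id_le (φ j)))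
      linarith
    calc ∫⁻ z in Ioo (-2 : ℝ) (-1) ×ˢ Metric.ball (0 : EuclideanSpace ℝ (Fin 3)) R,
          ‖nsRescale c (v (ψ (φ j))) z.1 z.2 - v (ψ (φ j)) z.1 z.2‖ₑ ^ 2
        = ∫⁻ z in Ioo (-2 : ℝ) (-1) ×ˢ Metric.ball (0 : EuclideanSpace ℝ (Fin 3)) R,
          ‖nsRescale c (u (ψ (φ j))) z.1 z.2 - u (ψ (φ j)) z.1 z.2‖ₑ ^ 2 :=
          (hCongr (u (ψ (φ j))) (v (ψ (φ j))) c R hc0 (hae _)).symm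
      _ ≤ ∫⁻ z in Ioo (-2 : ℝ) (-1) ×ˢ
            Metric.ball (0 : EuclideanSpace ℝ (Fin 3)) (((ψ (φ j) : ℕ) : ℝ) + 1),
          ‖nsRescale c (u (ψ (φ j))) z.1 z.2 - u (ψ (φ j)) z.1 z.2‖ₑ ^ 2 :=
          lintegral_mono_set (prod_mono Subset.rfl (Metric.ball_subset_ball hjR))
      _ ≤ ENNReal.ofReal (1 / (((ψ (φ j) : ℕ) : ℝ) + 1)) := hsmall (ψ (φ j)) c hc1 hc2
  -- ## (7) `W` is scale invariant on the window, so its slice `-3/2` is constant (S1a, S4)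
  have hWinv := hInv (fun j => v (ψ (φ j))) W (fun j => (hv (ψ (φ j))).continuousOn_uncurry)
    hW.continuousOn_uncurry hpt hincr
  obtain ⟨b, hb⟩ := hLeray C W hW hWinv
  -- ## (8) contradiction: an origin-singular Type-I ancient mild field has no irrotational slice
  obtain ⟨x, hx⟩ := exists_curl_ne_zero_of_isBackwardSingularPoint hW hsingW (-3 / 2) (by norm_num)
  have hslice : W (-3 / 2) = fun _ => b := funext hb
  rw [hslice, gkS1_curl_const] at hx
  exact hx rfl

end Summit.NavierStokesRegularity.NavierStokesRegularity.Theorems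

end
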